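import Summits.ResolutionOfSingularities.ResolutionOfSingularities.Theorems.EquisingularLiftEquisingularLiftNatKeyFormSectionDictionary
import Summits.ResolutionOfSingularities.ResolutionOfSingularities.Theorems.EquisingularLiftEquisingularLiftNatKeyFormLift
import Summits.ResolutionOfSingularities.ResolutionOfSingularities.Theorems.EquisingularLiftEquisingularLiftNatKeyFormModel
import Summits.ResolutionOfSingularities.ResolutionOfSingularities.Theorems.EquisingularLiftEquisingularLiftNatKeyFormModelTrace
import Summits.ResolutionOfSingularities.ResolutionOfSingularities.Theorems.EquisingularLiftEquisingularLiftNatKeyFormGauge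
import Summits.ResolutionOfSingularities.ResolutionOfSingularities.Theorems.EquisingularLiftEquisingularLiftNatKeyFormOrderAt
import HarnessLib

/-!
# [OURS · L1 W4.5(b) · EL♮(3) · WIDTH TABLE D5 «IMMATURE HOST», supplier row HOPEN, input (IN-1)] THE JOINT BIRTH
# `TCPlus.opening_birth k H ι : hBirth` — the `hBirth` hypothesis of ✓ `TCPlus.opening_pointPhase` (p671938) and of
# ✓ `TCPlus.hopen_supplier_of₂` (p673794), VERBATIM, assembled from the seven KeyForm bricks (B0)–(B6)

res-L1-w45b-stub-4 g12 (STUB WORKER 4 of crux chain w45b; desk RULINGS R59/R60 2026-08-28: «(B7) assembly = stub-4»). Crux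
`EquisingularLiftNatThree` = stmt-ResolutionOfSingularities-20148 (parent stmt-…-20038), route `EquisingularLift`, line `sections`. OURS —
NOT a statement of any manuscript ([Hironaka2017] is a candidate under adjudication; nothing of it is asserted); AI-written, weaker than
expert review. No `sorry`, no new definition, no instance attribute; standard axioms. `--supports stmt-ResolutionOfSingularities-20148 --as helper`.

WHAT. In the EL♮(3) ambient `ℙ³_O → Spec O` (`O` a complete DVR with residue map `θ : O ↠ k`, `k` algebraically closed, special fibre
`g = Proj φ : ℙ³_k → ℙ³_O`), given a section `s` of `q` through `g x₀`, letters `ℓ ∈ ℓh :: ℓj :: ℓs` (non-zero linear forms through `x₀` not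
containing the integral closed subscheme `ι : H ↪ ℙ³_k`) and an IMMATURE KEY FORM `G = ℓh^a·U + ℓh·R₁ + R₂·ℓj` of degree `e` (`a ≥ 2`,
`R₁, R₂ ∈ 𝔭_{x₀}^a`, `U ∉ 𝔭_{x₀}`, `H ⊄ V₊(G)`, (A2) every affine dehomogenisation of `G` generates a radical ideal), ALL the models are born
at the initial stage at once: a letter model `𝓛 ℓ` for every letter (regular hyperplane `V₊(ℓ̃) ∋ s`, reduced trace `V₊(ℓ)`, principal stalks,
off the generic point of `H`, `O`-flat, `𝓛 ℓ ≤ ker s`) and the key model `𝓜 = (G̃)~` of a homogeneous `θ`-lift `G̃` of `G` with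
`𝓜·𝒪_{ℙ³_k} = 𝓘⟨closure V₊(G)⟩`, principal stalks, off `H`'s generic point, `O`-flat, `𝓜 ≠ ⊥`, the GAUGE
`𝓜 ≤ (𝓛 ℓh)^a ⊔ 𝓛 ℓh · (ker s)^a ⊔ (ker s)^a · 𝓛 ℓj`, and a stalk generator `Gst` of `𝓜` at `g x₀` lying in `(ker s)_{g x₀}^a` whose image
in `𝒪_{ℙ³_k, x₀}` has order EXACTLY `a` (`∉ 𝔪^{a+1}`).

HOW (pure composition; the statement is the `hBirth` binder of p671938, lines 49–64, byte for byte):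
* SECTION DATA (res-type-027): a chart `D₊(x_{i₀}) ⊇ s(Spec O)` (✓ `LinearLetter.exists_chart_of_section`), the coordinate homomorphism `Φ`
  of `s` on it (✓ `LinearLetter.exists_sectionPull`) and the coordinates `a_j = Φ(x_j/x_{i₀})`, `a_{i₀} = 1` (✓ `LinearLetter.coord_self`);
* (B0) ✓ `KeyForm.section_coords_dictionary` (p675313): `F ∈ 𝔭_{x₀} ↔ F(θ a) = 0` for forms of positive degree; (B2a) ✓
  `KeyForm.asHomogeneousIdeal_toIdeal_eq_span` (p675042): `𝔭_{x₀} = (x_j − θ(a_j) x_{i₀})_j`;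
* LETTERS: ✓ `LinearLetter.exists_letter_model_le_ker` (p635807, res-type-027 (H3)) gives, for each letter, the graded substitution `f_ℓ` killing
  `ℓ̃ = Σ c_i x_i` (`θ ℓ̃ = ℓ`) with the five clauses and `ker (Proj f_ℓ) ≤ ker s`; `𝓛 ℓ := ker (Proj f_ℓ)` (and `⊥` off the letter condition);
* (B2b) ✓ `KeyForm.exists_keyForm_lift` (p675042): a homogeneous lift `G̃` of `G` INSIDE `(ℓ̃h^a) + (ℓ̃h)·𝔓^a + 𝔓^a·(ℓ̃j)`, `𝔓 = (x_j − a_j x_{i₀})_j`;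
* (B3) ✓ `KeyForm.keyModel_clauses` (p674833, res-type-027): principal stalks, `≠ ⊥`, flat (`θ G̃ = G ≠ 0` because `H ⊄ V₊(G)`; `e > 0` because
  `G ∈ 𝔭_{x₀}` is not a unit);
* (B4) ✓ `KeyForm.keyModel_trace` (p675170, res-type-027): reduced trace `𝓘⟨closure V₊(G)⟩` and position off `H`'s generic point, from (A2);
* (B5) ✓ `KeyForm.keyModel_le_gauge` (p675956, res-type-027): the gauge, from (B2b)'s polynomial membership pushed through the charts;
* (B6) ✓ `KeyForm.keyModel_order_at` (p675837, res-L1-w45b-stub-2): the stalk generator `Gst = germ (G̃/x_{i₀}^e)`, `Gst ∈ (ker s)^a_{g x₀}`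
  (from the gauge and `𝓛 ℓ ≤ ker s`), and order exactly `a` downstairs.

References: [Hartshorne1977, II Prop. 2.5, 5.9, Cor. 5.16, III Prop. 9.7]; Q. Liu, *Algebraic Geometry and Arithmetic Curves* (2002),
Thm. 8.1.19 [Liu2002] — through the cited tree files (all OURS, imported).
-/

set_option linter.dupNamespace false -- mandated namespace `Summit.<Summit>.<Problem>` of this single-conjunct summit
set_option linter.overlappingInstances false -- the binder carries `[IsDomain O] [IsDiscreteValuationRing O]`

noncomputable section

open CategoryTheory CategoryTheory.Limits AlgebraicGeometry TopologicalSpace Topology IsLocalRing MvPolynomial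
open HomogeneousLocalization
open Literature.AlgebraicGeometry.Motives (projectiveSpace)
open Literature.AlgebraicGeometry.Motives.Segre (frac cst)
open Literature.AlgebraicGeometry.Motives.GeneratingSections (preU)
open Literature.AlgebraicGeometry.Resolution AlgebraicGeometry.Scheme.IdealSheafData

namespace Summit.ResolutionOfSingularities.ResolutionOfSingularities.Cruxes.EquisingularLiftNat.Sections

/-- ★ **(IN-1) THE JOINT BIRTH** — the `hBirth` hypothesis of ✓ `TCPlus.opening_pointPhase` / ✓ `TCPlus.hopen_supplier_of₂`, VERBATIM (see the
module docstring): every letter model and the immature key letter's model are born at the initial stage `ℙ³_O`, with the gauge and the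
exact order `a` at `x₀`. [cite: Hartshorne1977, II Prop. 5.9, III Prop. 9.7] [OURS · L1 W4.5b · WIDTH TABLE D5, supplier row HOPEN (IN-1)] -/
theorem TCPlus.opening_birth (k : Type) [Field k] [IsAlgClosed k] (H : Scheme.{0}) (ι : H ⟶ (projectiveSpace 3 k).left) [IsIntegral H]
    [IsClosedImmersion ι] :
    (∀ (O : Type) [CommRing O] [IsDomain O] [IsDiscreteValuationRing O] [IsAdicComplete (IsLocalRing.maximalIdeal O) O] [IsAlgClosed (IsLocalRing.ResidueField O)]
        (θ : O →+* k), Function.Surjective θ → (letI := MvPolynomial.gradedAlgebra (σ := Fin (3 + 1)) (R := O); letI := MvPolynomial.gradedAlgebra (σ := Fin (3 + 1)) (R := k);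
      ∀ (φ : homogeneousSubmodule (Fin (3 + 1)) O →+*ᵍ homogeneousSubmodule (Fin (3 + 1)) k)
        (hφ' : HomogeneousIdeal.irrelevant (homogeneousSubmodule (Fin (3 + 1)) k) ≤ (HomogeneousIdeal.irrelevant (homogeneousSubmodule (Fin (3 + 1)) O)).map φ),
        (∀ s, φ s = MvPolynomial.map θ s) →
      ∀ (s : Spec (.of O) ⟶ (Proj (homogeneousSubmodule (Fin (3 + 1)) O))), s ≫ (Proj.toSpecZero (homogeneousSubmodule (Fin (3 + 1)) O) ≫ Spec.map (CommRingCat.ofHom (algebraMap O (homogeneousSubmodule (Fin (3 + 1)) O 0)))) = 𝟙 _ →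
      ∀ (x₀ : (projectiveSpace 3 k).left), s (IsLocalRing.closedPoint O) = (Proj.map φ hφ' : (projectiveSpace 3 k).left ⟶ Proj (homogeneousSubmodule (Fin (3 + 1)) O)) x₀ →
      ∀ (ℓh ℓj : MvPolynomial (Fin (3 + 1)) k) (ℓs : List (MvPolynomial (Fin (3 + 1)) k)) (G U R₁ R₂ : MvPolynomial (Fin (3 + 1)) k) (e a : ℕ),
        (∀ ℓ ∈ ℓh :: ℓj :: ℓs, ℓ.IsHomogeneous 1 ∧ ℓ ≠ 0 ∧ x₀ ∈ {y : (projectiveSpace 3 k).left | ℓ ∈ (y : ProjectiveSpectrum (homogeneousSubmodule (Fin (3 + 1)) k)).asHomogeneousIdeal} ∧ ¬ (Set.range ι ⊆ {y : (projectiveSpace 3 k).left | ℓ ∈ (y : ProjectiveSpectrum (homogeneousSubmodule (Fin (3 + 1)) k)).asHomogeneousIdeal})) →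
        G.IsHomogeneous e → 2 ≤ a → G = ℓh ^ a * U + ℓh * R₁ + R₂ * ℓj → R₁ ∈ ((x₀ : ProjectiveSpectrum (homogeneousSubmodule (Fin (3 + 1)) k)).asHomogeneousIdeal).toIdeal ^ a → R₂ ∈ ((x₀ : ProjectiveSpectrum (homogeneousSubmodule (Fin (3 + 1)) k)).asHomogeneousIdeal).toIdeal ^ a → U ∉ ((x₀ : ProjectiveSpectrum (homogeneousSubmodule (Fin (3 + 1)) k)).asHomogeneousIdeal) →
        ¬ (Set.range ι ⊆ {y : (projectiveSpace 3 k).left | G ∈ (y : ProjectiveSpectrum (homogeneousSubmodule (Fin (3 + 1)) k)).asHomogeneousIdeal}) → (∀ i : Fin (3 + 1), (Ideal.span {MvPolynomial.aeval (Function.update MvPolynomial.X i (1 : MvPolynomial (Fin (3 + 1)) k)) G}).IsRadical) →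
        ∃ (𝓛 : MvPolynomial (Fin (3 + 1)) k → ((Proj (homogeneousSubmodule (Fin (3 + 1)) O))).IdealSheafData) (𝓜 : ((Proj (homogeneousSubmodule (Fin (3 + 1)) O))).IdealSheafData) (Gst : ((Proj (homogeneousSubmodule (Fin (3 + 1)) O))).presheaf.stalk ((Proj.map φ hφ' : (projectiveSpace 3 k).left ⟶ Proj (homogeneousSubmodule (Fin (3 + 1)) O)) x₀)),
          (∀ ℓ ∈ ℓh :: ℓj :: ℓs, ((𝓛 ℓ).comap (Proj.map φ hφ' : (projectiveSpace 3 k).left ⟶ Proj (homogeneousSubmodule (Fin (3 + 1)) O)) = vanishingIdeal (⟨closure {y : (projectiveSpace 3 k).left | ℓ ∈ (y : ProjectiveSpectrum (homogeneousSubmodule (Fin (3 + 1)) k)).asHomogeneousIdeal}, isClosed_closure⟩ : Closeds (projectiveSpace 3 k).left) ∧ (∀ z : ↥(Proj (homogeneousSubmodule (Fin (3 + 1)) O)), (stalkIdeal (𝓛 ℓ) z).IsPrincipal) ∧ Scheme.IsRegular (𝓛 ℓ).subscheme ∧ (𝟙 (Proj (homogeneousSubmodule (Fin (3 + 1)) O))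 : _ ⟶ _) '' ((𝓛 ℓ).support : Set ↥(Proj (homogeneousSubmodule (Fin (3 + 1)) O))) ⊆ {y : ↥(Proj (homogeneousSubmodule (Fin (3 + 1)) O)) | ¬ IsGenericPoint y (Set.range (ι ≫ Proj.map φ hφ' : H ⟶ Proj (homogeneousSubmodule (Fin (3 + 1)) O)))} ∧ Flat ((𝓛 ℓ).subschemeι ≫ 𝟙 (Proj (homogeneousSubmodule (Fin (3 + 1)) O)) ≫ (Proj.toSpecZero (homogeneousSubmodule (Fin (3 + 1)) O) ≫ Spec.map (CommRingCat.ofHom (algebraMap O (homogeneousSubmodule (Fin (3 + 1)) O 0)))))) ∧ 𝓛 ℓ ≤ s.ker) ∧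
          ((𝓜).comap (Proj.map φ hφ' : (projectiveSpace 3 k).left ⟶ Proj (homogeneousSubmodule (Fin (3 + 1)) O)) = vanishingIdeal (⟨closure {y : (projectiveSpace 3 k).left | G ∈ (y : ProjectiveSpectrum (homogeneousSubmodule (Fin (3 + 1)) k)).asHomogeneousIdeal}, isClosed_closure⟩ : Closeds (projectiveSpace 3 k).left) ∧ (∀ z : ↥(Proj (homogeneousSubmodule (Fin (3 + 1)) O)), (stalkIdeal (𝓜) z).IsPrincipal) ∧ (𝟙 (Proj (homogeneousSubmodule (Fin (3 + 1)) O)) : _ ⟶ _) '' ((𝓜).support : Set ↥(Proj (homogeneousSubmodule (Fin (3 + 1)) O))) ⊆ {y : ↥(Proj (homogeneousSubmodule (Fin (3 + 1)) O)) | ¬ IsGenericPoint y (Set.range (ι ≫ Proj.map φ hφ' : H ⟶ Proj (homogeneousSubmodule (Fin (3 + 1)) O)))} ∧ Flat ((𝓜).subschemeι ≫ 𝟙 (Proj (homogeneousSubmodule (Fin (3 + 1)) O)) ≫ (Proj.toSpecZero (homogeneousSubmodule (Fin (3 + 1)) O) ≫ Spec.map (CommRingCat.ofHom (algebraMap O (homogeneousSubmodule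 (Fin (3 + 1)) O 0)))))) ∧ 𝓜 ≠ ⊥ ∧
          𝓜 ≤ (𝓛 ℓh) ^ a ⊔ 𝓛 ℓh * s.ker ^ a ⊔ s.ker ^ a * 𝓛 ℓj ∧
          stalkIdeal 𝓜 ((Proj.map φ hφ' : (projectiveSpace 3 k).left ⟶ Proj (homogeneousSubmodule (Fin (3 + 1)) O)) x₀) = Ideal.span {Gst} ∧ Gst ∈ stalkIdeal s.ker ((Proj.map φ hφ' : (projectiveSpace 3 k).left ⟶ Proj (homogeneousSubmodule (Fin (3 + 1)) O)) x₀) ^ a ∧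
          ((Proj.map φ hφ' : (projectiveSpace 3 k).left ⟶ Proj (homogeneousSubmodule (Fin (3 + 1)) O)).stalkMap x₀).hom Gst ∉ IsLocalRing.maximalIdeal (((projectiveSpace 3 k).left).presheaf.stalk x₀) ^ (a + 1))) := by
  intro O _ _ _ _ _ θ hθ
  letI := MvPolynomial.gradedAlgebra (σ := Fin (3 + 1)) (R := O)
  letI := MvPolynomial.gradedAlgebra (σ := Fin (3 + 1)) (R := k)
  letI := MvPolynomial.gradedAlgebra (σ := Fin (2 + 1)) (R := O)
  intro φ hφ' hφ s hs x₀ hsx ℓh ℓj ℓs G U R₁ R₂ e a hℓ hG ha hGeq hR₁ hR₂ hU hH hA2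
  classical
  -- the closed immersion, retyped over `Proj k[x₀,…,x₃]` (instance search does not unfold `projectiveSpace`)
  haveI hιP : @IsClosedImmersion H (Proj (homogeneousSubmodule (Fin (3 + 1)) k)) ι := ‹IsClosedImmersion ι›
  /- SECTION DATA: a chart containing the section, its coordinate homomorphism, the coordinates -/
  obtain ⟨i₀, htop⟩ := LinearLetter.exists_chart_of_section s
  obtain ⟨Φ, hΦs, hΦcst⟩ := LinearLetter.exists_sectionPull s i₀ htop hs
  obtain ⟨av, hav⟩ : ∃ av : Fin (3 + 1) → O, ∀ j, av j = (Scheme.ΓSpecIso (.of O)).hom (Φ (frac O i₀ j)) := ⟨_, fun _ => rfl⟩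
  have hav₀ : av i₀ = 1 := by rw [hav]; exact LinearLetter.coord_self i₀ Φ
  have hx₀i : (Proj.map φ hφ' : (projectiveSpace 3 k).left ⟶ Proj (homogeneousSubmodule (Fin (3 + 1)) O)) x₀ ∈ Proj.basicOpen (homogeneousSubmodule (Fin (3 + 1)) O) (X i₀) := by
    rw [← hsx]
    exact htop (Set.mem_univ _)
  /- (B0) the dictionary `F ∈ 𝔭_{x₀} ↔ F(θ a) = 0`, (B2a) the point's ideal -/
  have hD : ∀ (m : ℕ), 0 < m → ∀ (F : MvPolynomial (Fin (3 + 1)) k), F ∈ homogeneousSubmodule (Fin (3 + 1)) k m →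
      (F ∈ (x₀ : ProjectiveSpectrum (homogeneousSubmodule (Fin (3 + 1)) k)).asHomogeneousIdeal ↔ MvPolynomial.eval (fun j => θ (av j)) F = 0) := by
    intro m hm F hF
    have hfun : (fun j => θ (av j)) = fun j => θ ((Scheme.ΓSpecIso (.of O)).hom (Φ (frac O i₀ j))) := funext fun j => by rw [hav]
    rw [hfun]
    exact KeyForm.section_coords_dictionary O θ hθ φ hφ' hφ s hs i₀ htop Φ hΦs hΦcst x₀ hsx m hm F hF
  have hp : (x₀ : ProjectiveSpectrum (homogeneousSubmodule (Fin (3 + 1)) k)).asHomogeneousIdeal.toIdeal =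
      Ideal.span (Set.range fun j : Fin (3 + 1) => X j - C (θ (av j)) * X i₀) :=
    KeyForm.asHomogeneousIdeal_toIdeal_eq_span x₀ (fun j => θ (av j)) i₀ (by simp only [hav₀, map_one]) hD
  /- THE LETTERS: a model through the section for every letter -/
  have hsup : ∀ ℓ : MvPolynomial (Fin (3 + 1)) k, ∃ 𝓛ℓ : (Proj (homogeneousSubmodule (Fin (3 + 1)) O)).IdealSheafData,
      (ℓ.IsHomogeneous 1 ∧ ℓ ≠ 0 ∧ x₀ ∈ {y : (projectiveSpace 3 k).left | ℓ ∈ (y : ProjectiveSpectrum (homogeneousSubmodule (Fin (3 + 1)) k)).asHomogeneousIdeal} ∧ ¬ (Set.range ι ⊆ {y : (projectiveSpace 3 k).left | ℓ ∈ (y : ProjectiveSpectrum (homogeneousSubmodule (Fin (3 + 1)) k)).asHomogeneousIdeal})) →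
      ((𝓛ℓ.comap (Proj.map φ hφ' : (projectiveSpace 3 k).left ⟶ Proj (homogeneousSubmodule (Fin (3 + 1)) O)) = vanishingIdeal (⟨closure {y : (projectiveSpace 3 k).left | ℓ ∈ (y : ProjectiveSpectrum (homogeneousSubmodule (Fin (3 + 1)) k)).asHomogeneousIdeal}, isClosed_closure⟩ : Closeds (projectiveSpace 3 k).left) ∧ (∀ z : ↥(Proj (homogeneousSubmodule (Fin (3 + 1)) O)), (stalkIdeal 𝓛ℓ z).IsPrincipal) ∧ Scheme.IsRegular 𝓛ℓ.subscheme ∧ (𝟙 (Proj (homogeneousSubmodule (Fin (3 + 1)) O)) : _ ⟶ _) '' (𝓛ℓ.support : Set ↥(Proj (homogeneousSubmodule (Fin (3 + 1)) O))) ⊆ {y : ↥(Proj (homogeneousSubmodule (Fin (3 + 1)) O)) | ¬ IsGenericPoint y (Set.range (ι ≫ Proj.map φ hφ' : H ⟶ Proj (homogeneousSubmodule (Fin (3 + 1)) O)))} ∧ Flat (𝓛ℓ.subschemeι ≫ 𝟙 (Proj (homogeneousSubmodule (Fin (3 + 1)) O)) ≫ (Proj.toSpecZero (homogeneousSubmodule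 (Fin (3 + 1)) O) ≫ Spec.map (CommRingCat.ofHom (algebraMap O (homogeneousSubmodule (Fin (3 + 1)) O 0)))))) ∧ 𝓛ℓ ≤ s.ker) ∧
      ∃ (L : MvPolynomial (Fin (3 + 1)) O) (jℓ : Fin (3 + 1)) (f : homogeneousSubmodule (Fin (3 + 1)) O →+*ᵍ homogeneousSubmodule (Fin (2 + 1)) O)
        (hf' : HomogeneousIdeal.irrelevant (homogeneousSubmodule (Fin (2 + 1)) O) ≤ (HomogeneousIdeal.irrelevant (homogeneousSubmodule (Fin (3 + 1)) O)).map f),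
        L.IsHomogeneous 1 ∧ MvPolynomial.map θ L = ℓ ∧ (∀ b : O, f (C b) = C b) ∧ (∀ j : Fin (2 + 1), f (X (Fin.succAbove jℓ j)) = X j) ∧
          RingHom.ker f = Ideal.span {L} ∧ 𝓛ℓ = (Proj.map f hf').ker := by
    intro ℓ
    by_cases hc : (ℓ.IsHomogeneous 1 ∧ ℓ ≠ 0 ∧ x₀ ∈ {y : (projectiveSpace 3 k).left | ℓ ∈ (y : ProjectiveSpectrum (homogeneousSubmodule (Fin (3 + 1)) k)).asHomogeneousIdeal} ∧ ¬ (Set.range ι ⊆ {y : (projectiveSpace 3 k).left | ℓ ∈ (y : ProjectiveSpectrum (homogeneousSubmodule (Fin (3 + 1)) k)).asHomogeneousIdeal}))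
    · obtain ⟨hℓ1, hℓ0, hxℓ, hHℓ⟩ := hc
      obtain ⟨c, jℓ, f, hf', hcℓ, hfC, hfe, hker, h1, h2, h3, h4, h5, hle⟩ :=
        @LinearLetter.exists_letter_model_le_ker O k _ _ _ _ θ hθ 2 φ hφ hφ' s hs x₀ hsx ℓ hℓ1 hℓ0 hxℓ H _ ι hιP hHℓ
      exact ⟨(Proj.map f hf').ker, fun _ => ⟨⟨⟨h1, h2, h3, h4, h5⟩, hle⟩, ∑ i, C (c i) * X i, jℓ, f, hf',
        LinearLetter.isHomogeneous_sum_C_mul_X_one (r := 2) c, hcℓ, hfC, hfe, hker, rfl⟩⟩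
    · exact ⟨⊥, fun h => absurd h hc⟩
  choose 𝓛 h𝓛 using hsup
  have hch := hℓ ℓh (by simp)
  have hcj := hℓ ℓj (by simp)
  obtain ⟨Lh, jh, fh, hfh', hLh1, hLhθ, hfhC, hfhe, hkerh, h𝓛h⟩ := (h𝓛 ℓh hch).2
  obtain ⟨Lj, jj, fj, hfj', hLj1, hLjθ, hfjC, hfje, hkerj, h𝓛j⟩ := (h𝓛 ℓj hcj).2
  have hℓhx : ℓh ∈ (x₀ : ProjectiveSpectrum (homogeneousSubmodule (Fin (3 + 1)) k)).asHomogeneousIdeal := hch.2.2.1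
  have hℓjx : ℓj ∈ (x₀ : ProjectiveSpectrum (homogeneousSubmodule (Fin (3 + 1)) k)).asHomogeneousIdeal := hcj.2.2.1
  /- (B2b) THE KEY FORM: a homogeneous `θ`-lift of `G` inside `(L̃h^a) + (L̃h)·𝔓^a + 𝔓^a·(L̃j)` -/
  have hGeq' : G = MvPolynomial.map θ Lh ^ a * U + MvPolynomial.map θ Lh * R₁ + R₂ * MvPolynomial.map θ Lj := by
    rw [hLhθ, hLjθ]; exact hGeq
  have hR₁' : R₁ ∈ Ideal.span (Set.range fun j : Fin (3 + 1) => X j - C (θ (av j)) * X i₀) ^ a := by rw [← hp]; exact hR₁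
  have hR₂' : R₂ ∈ Ideal.span (Set.range fun j : Fin (3 + 1) => X j - C (θ (av j)) * X i₀) ^ a := by rw [← hp]; exact hR₂
  obtain ⟨Gt, hGte, hGtG, hmem⟩ := KeyForm.exists_keyForm_lift θ hθ av i₀ Lh Lj hLh1 hLj1 G U R₁ R₂ e a hG hGeq' hR₁' hR₂'
  have hGt : Gt ∈ homogeneousSubmodule (Fin (3 + 1)) O e := (mem_homogeneousSubmodule _ _).mpr hGte
  -- `G ≠ 0` (`H ⊄ V₊(G)`), `G ∈ 𝔭_{x₀}`, hence `e > 0`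
  have hG0 : G ≠ 0 := by
    intro h0
    apply hH
    intro y _
    rw [h0]
    exact Set.mem_setOf.mpr (HomogeneousIdeal.mem_iff.mp (Ideal.zero_mem _))
  have hGt0 : MvPolynomial.map θ Gt ≠ 0 := hGtG ▸ hG0
  have hGI : G ∈ (x₀ : ProjectiveSpectrum (homogeneousSubmodule (Fin (3 + 1)) k)).asHomogeneousIdeal.toIdeal := by
    have hh : ℓh ∈ (x₀ : ProjectiveSpectrum (homogeneousSubmodule (Fin (3 + 1)) k)).asHomogeneousIdeal.toIdeal := hℓhx
    have hj : ℓj ∈ (x₀ : ProjectiveSpectrum (homogeneousSubmodule (Fin (3 + 1)) k)).asHomogeneousIdeal.toIdeal := hℓjx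
    rw [hGeq]
    exact add_mem (add_mem (Ideal.mul_mem_right _ _ (Ideal.pow_mem_of_mem _ hh a (by omega))) (Ideal.mul_mem_right _ _ hh))
      (Ideal.mul_mem_left _ _ hj)
  have he : 0 < e := by
    by_contra he0
    obtain rfl : e = 0 := by omega
    have hC : G = C (coeff 0 G) := totalDegree_eq_zero_iff_eq_C.mp (le_antisymm hG.totalDegree_le (Nat.zero_le _))
    have hc0 : coeff 0 G ≠ 0 := fun h => hG0 (by rw [hC, h, C_0])
    have hunit : IsUnit G := by rw [hC]; exact (IsUnit.mk0 _ hc0).map C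
    exact (x₀ : ProjectiveSpectrum (homogeneousSubmodule (Fin (3 + 1)) k)).isPrime.ne_top (Ideal.eq_top_of_isUnit_mem _ hGI hunit)
  /- (B3) clauses, (B4) trace and position, (B5) gauge, (B6) order at `x₀` -/
  obtain ⟨hM2, hMne, hM4⟩ := KeyForm.keyModel_clauses O θ hθ Gt e he hGt hGt0
  obtain ⟨hM1, hM3⟩ := KeyForm.keyModel_trace O θ hθ φ hφ' hφ ι Gt e he hGt G hGtG hG0 hH hA2
  have hB5 : projIdealSheaf (homogeneousSubmodule (Fin (3 + 1)) O) ⟨Ideal.span (Set.range fun _ : Fin 1 => Gt), isHomogeneous_span_of_forall_mem _ (fun _ : Fin 1 => Gt) (fun _ => e) (fun _ => hGt)⟩ ≤ (𝓛 ℓh) ^ a ⊔ 𝓛 ℓh * s.ker ^ a ⊔ s.ker ^ a * 𝓛 ℓj := by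
    rw [h𝓛h, h𝓛j]
    exact KeyForm.keyModel_le_gauge O (r := 2) s hs i₀ htop Φ hΦs hΦcst av hav Lh Lj hLh1 hLj1 jh jj fh hfh' hfhC hfhe hkerh
      fj hfj' hfjC hfje hkerj Gt e a hGt hmem
  have hle : projIdealSheaf (homogeneousSubmodule (Fin (3 + 1)) O) ⟨Ideal.span (Set.range fun _ : Fin 1 => Gt), isHomogeneous_span_of_forall_mem _ (fun _ : Fin 1 => Gt) (fun _ => e) (fun _ => hGt)⟩ ≤ s.ker ^ a := by
    refine hB5.trans (sup_le (sup_le (pow_le_pow_left' (h𝓛 ℓh hch).1.2 a) ?_) ?_)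
    · calc 𝓛 ℓh * s.ker ^ a ≤ ⊤ * s.ker ^ a := mul_le_mul' le_top le_rfl
        _ = s.ker ^ a := Scheme.IdealSheafData.top_mul _
    · calc s.ker ^ a * 𝓛 ℓj ≤ s.ker ^ a * ⊤ := mul_le_mul' le_rfl le_top
        _ = s.ker ^ a := Scheme.IdealSheafData.mul_top _
  obtain ⟨h61, h62, h63⟩ := KeyForm.keyModel_order_at O θ hθ φ hφ' hφ x₀ i₀ hx₀i Gt e a he hGt ℓh ℓj G U R₁ R₂ hGtG hch.1 hch.2.1 hℓhx
    hcj.1 hℓjx hGeq hR₁ hR₂ hU s.ker hle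
  exact ⟨𝓛, projIdealSheaf (homogeneousSubmodule (Fin (3 + 1)) O) ⟨Ideal.span (Set.range fun _ : Fin 1 => Gt), isHomogeneous_span_of_forall_mem _ (fun _ : Fin 1 => Gt) (fun _ => e) (fun _ => hGt)⟩, _, fun ℓ hm => (h𝓛 ℓ (hℓ ℓ hm)).1, ⟨hM1, hM2, hM3, hM4⟩, hMne, hB5, h61, h62, h63⟩

end Summit.ResolutionOfSingularities.ResolutionOfSingularities.Cruxes.EquisingularLiftNat.Sections

end
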